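/-
Copyright (c) 2026. All rights reserved.
Released under Apache 2.0 license as described in the file LICENSE.
-/
import Summits.HodgeConjecture.HodgeConjecture.Theorems.K2LiuArchFlatTubePresentation      -- ★ FILE 18 PRESENTATION HEAD
import Summits.HodgeConjecture.HodgeConjecture.Theorems.K2LiuArchFaceOfPresentation        -- ★ K2Liu-p13 (g4)'s ASSEMBLY HALF `archFace_of_presentation`
import Mathlib.Analysis.SpecialFunctions.Pow.Deriv
import Summits.HodgeConjecture.HodgeConjecture.Theorems.K2LiuHermitianTubeFrameSign         -- ★ arch₄ (the frame package of record)
import Summits.HodgeConjecture.HodgeConjecture.Theorems.K2LiuArchReadingFrame               -- ★ reading frames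
import Summits.HodgeConjecture.HodgeConjecture.Theorems.K2LiuArchSiegelCharacterTubeConsumer -- ★ `tube_eq_of_chart_formula`
import Summits.HodgeConjecture.HodgeConjecture.Theorems.K2LiuArchFrameBridge                -- ★ `kappa_eq`
import HarnessLib

/-!
# Crux `HLiu418`, G6-arch ASSEMBLY FILE 20 — (E8rec) THE ARCH FACE OF RECORD: K2Liu-p13 (g4)'s `hArch` letter (📤 p862797
# `K2LiuBigCellContinuation.exists_bigCell_continuation_cm`) at `n = 2`, for every Hecke character of odd unitary archimedean type, MODULO ONE LETTER —
# the conjugator of the standard datum's archimedean compact into the tube frame's `Stab(i·1)` (S2 (B) lineage: ★ B2 `exists_conj_archCompact` + sign-block reading)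

Cell `hodgecm-mathlib`, crux item hLiu418 = `stmt-HodgeConjecture-24832` (helper lane `--supports`, count-neutral).  K2Liu-p11 (g4).
* **`archFace_of_conjugator`** — `(hconj : ∀ 𝒦′ standard, for the EXPLICIT Shimura frame (T_w, T_w⁻¹) of ★ arch₄ (x), ∃ g ∈ H_∞ with
  (∀ w, T_w·k_w·T_w⁻¹ ∈ Stab(i1)) → (g k g⁻¹, 1) ∈ 𝒦′.K)` ⟹ the `hArch` bytes VERBATIM at `n = 2` with `toHeckeCharacter L lam⁻¹` generalised to any `χ` of unitary
  archimedean type `(t, 0)`, `t` odd (for `lam` conjugate-symplectic: ★ `hasUnitaryArchType_toHeckeCharacter`-type lemmas on p13's side).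
  Road: frames of record (★ `exists_tubeFrame_arch₄`, `choose` over the complex places), Shimura shape (★ `isUnit_det_shimuraFrame`, ★ `tw_ne_zero`), reading frames
  (★ `exists_readingFrame` + ★ `tube_eq_of_chart_formula` + ★ `kappa_eq`), (E6′) law ⇒ ★ `isArchSiegelDeltaSection_of_finPart_eq_one`, ★ FILE 18
  `exists_flat_tube_presentation`, ★ K2Liu-p13's `archFace_of_presentation` at `F s a := H_{𝒦′}(a)^{2(s−s₀)}·A a`, `γ r s := c_r·H_{𝒦′}(g⁻¹)^{2(s−s₀)}`, `κ_∞`.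
References: [Shimura1997, §§5–6, §16.4]; [KudlaRallis1994, §1]; [Tan1999, §3]; [BorelJacquet1979, §4.1].
HONEST LABEL: HC_CM is proved only modulo the 7 printed citations (2 remaining named inputs: hLiu418 = stmt-HodgeConjecture-24832,
h413 = stmt-HodgeConjecture-24833) until rung 0 closes; count-neutral helper, closes no socket.
-/

set_option autoImplicit false
set_option linter.dupNamespace false

noncomputable section

open scoped Matrix ComplexConjugate Classical
open Complex Matrix MeasureTheory MeasureTheory.Measure NumberField NumberField.InfinitePlace
open Literature.NumberTheory.ModularForms.SiegelUpperHalfSpace (moeb)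
open Literature.NumberTheory.Automorphic Literature.NumberTheory.Automorphic.UnitaryGroup Literature.NumberTheory.GaloisRepresentations
open Literature.NumberTheory.GelbartRogawski1991 Literature.NumberTheory.GelbartRogawski1991.GRConstruction
open Literature.NumberTheory.GelbartRogawski1991.UnitaryDualPair
open Literature.NumberTheory.K2Lit.SiegelDoubled

namespace Summit.HodgeConjecture.HodgeConjecture.Cruxes.HLiu418.K2LiuArchFaceOfRecord

open K2LiuU22CompactPictureDefs K2LiuArchInducedTubeDefs K2LiuSiegelUnipotentLocalDefs K2LiuArchSWSpanningDefs
open K2LiuHermitianTubeFrameSign (exists_tubeFrame_arch₄)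
open K2LiuHermitianTubeFrameArch (tw_ne_zero)
open K2LiuArchSiegelCharacterTube (isUnit_det_shimuraFrame)
open K2LiuArchReadingFrame (exists_readingFrame)
open K2LiuArchSiegelCharacterTubeConsumer (tube_eq_of_chart_formula)
open K2LiuArchFrameBridge (kappa_eq)
open K2LiuArchFlatTubePresentation (exists_flat_tube_presentation)
open K2LiuArchFaceOfPresentation (archFace_of_presentation)

variable (L : Type) [Field L] [NumberField L] [IsCMField L] {N₀ M₀ : ℕ} (e : Fin N₀ × Fin M₀ ≃ Fin 2)
  (dV : Fin N₀ → L) (hdV : ∀ i, IsCMField.complexConj L (dV i) = dV i)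
  (dW : Fin M₀ → L) (hdW : ∀ i, IsCMField.complexConj L (dW i) = dW i)

/-- **(E8rec) THE ARCH FACE OF RECORD, modulo the conjugator letter** (see the module docstring). [Shimura1997, §16.4] [KudlaRallis1994, §1] [Tan1999, §3] -/
theorem archFace_of_conjugator (hdV0 : ∀ i, dV i ≠ 0) (hdW0 : ∀ i, dW i ≠ 0)
    {χ : HeckeCharacter L} {t : InfinitePlace L → ℤ} (ht : χ.HasUnitaryArchType t 0) (hodd : ∀ v : InfinitePlace L, Odd (t v))
    (hconj : ∀ 𝒦' : IwasawaDatum L e dV hdV dW hdW, 𝒦'.IsStd →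
      ∀ T Tinv : {w : InfinitePlace L // w.IsComplex} → Matrix (Fin 2 ⊕ Fin 2) (Fin 2 ⊕ Fin 2) ℂ,
        (∀ w, T w = fromBlocks (diagonal (fun k => (Real.sqrt (|(w.1.embedding (dV (e.symm k).1 * dW (e.symm k).2)).re| / 2) : ℂ))) (diagonal (fun k => (Real.sqrt (|(w.1.embedding (dV (e.symm k).1 * dW (e.symm k).2)).re| / 2) : ℂ)))
          (diagonal (fun k => I * ((((w.1.embedding (dV (e.symm k).1 * dW (e.symm k).2)).re / |(w.1.embedding (dV (e.symm k).1 * dW (e.symm k).2)).re|) * Real.sqrt (|(w.1.embedding (dV (e.symm k).1 * dW (e.symm k).2)).re| / 2) : ℝ) : ℂ))) (-diagonal (fun k => I * ((((w.1.embedding (dV (e.symm k).1 * dW (e.symm k).2)).re / |(w.1.embedding (dV (e.symm k).1 * dW (e.symm k).2)).re|) * Real.sqrt (|(w.1.embedding (dV (e.symm k).1 * dW (e.symm k).2)).re| / 2) : ℝ) : ℂ)))) →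
        (∀ w, Tinv w = fromBlocks (diagonal (fun k => (((Real.sqrt (|(w.1.embedding (dV (e.symm k).1 * dW (e.symm k).2)).re| / 2))⁻¹ / 2 : ℝ) : ℂ))) (-diagonal (fun k => I * (((Real.sqrt (|(w.1.embedding (dV (e.symm k).1 * dW (e.symm k).2)).re| / 2))⁻¹ * ((w.1.embedding (dV (e.symm k).1 * dW (e.symm k).2)).re / |(w.1.embedding (dV (e.symm k).1 * dW (e.symm k).2)).re|) / 2 : ℝ) : ℂ)))
          (diagonal (fun k => (((Real.sqrt (|(w.1.embedding (dV (e.symm k).1 * dW (e.symm k).2)).re| / 2))⁻¹ / 2 : ℝ) : ℂ))) (diagonal (fun k => I * (((Real.sqrt (|(w.1.embedding (dV (e.symm k).1 * dW (e.symm k).2)).re| / 2))⁻¹ * ((w.1.embedding (dV (e.symm k).1 * dW (e.symm k).2)).re / |(w.1.embedding (dV (e.symm k).1 * dW (e.symm k).2)).re|) / 2 : ℝ) : ℂ)))) →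
        ∃ g : UnitaryGroup.arch (Fp L) L (IsCMField.complexConj L) (2 + 2) (hermD L e dV hdV dW hdW), ∀ k : UnitaryGroup.arch (Fp L) L (IsCMField.complexConj L) (2 + 2) (hermD L e dV hdV dW hdW),
          (∀ w, moeb (T w * Matrix.reindex (e₂ (n := 2)).symm (e₂ (n := 2)).symm (((UnitaryGroup.archAt (Fp L) L (IsCMField.complexConj L) (2 + 2) (hermD L e dV hdV dW hdW) w (UnitaryGroup.complexConj_smul_infinitePlace L w.1) (IsCMField.complexConj_ne_one L) k : UnitaryGroup.archLocal L (2 + 2) (hermD L e dV hdV dW hdW) w) : GL (Fin (2 + 2)) ℂ) : Matrix (Fin (2 + 2)) (Fin (2 + 2)) ℂ) * Tinv w)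
            (I • (1 : Matrix (Fin 2) (Fin 2) ℂ)) = I • 1) →
          (UnitaryGroup.archToAdelic (Fp L) L (IsCMField.complexConj L) (2 + 2) (hermD L e dV hdV dW hdW) (g * k * g⁻¹) : HA L e dV hdV dW hdW) ∈ 𝒦'.K) :
    ∀ (𝒦' : IwasawaDatum L e dV hdV dW hdW), 𝒦'.IsStd →
      ∀ (s₀ : ℂ) (A : UnitaryGroup.arch (Fp L) L (IsCMField.complexConj L) (2 + 2) (hermD L e dV hdV dW hdW) → ℂ),
        (∀ p : HA L e dV hdV dW hdW, IsSiegelDelta L e dV hdV dW hdW p → UnitaryGroup.finPart (Fp L) L (IsCMField.complexConj L) (2 + 2) (hermD L e dV hdV dW hdW) p = 1 →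
          ∀ x : UnitaryGroup.arch (Fp L) L (IsCMField.complexConj L) (2 + 2) (hermD L e dV hdV dW hdW),
            A (UnitaryGroup.archPart (Fp L) L (IsCMField.complexConj L) (2 + 2) (hermD L e dV hdV dW hdW) p * x) = siegelDeltaCharacter L e dV hdV dW hdW χ s₀ p * A x) →
        (∃ V : Submodule ℂ (UnitaryGroup.arch (Fp L) L (IsCMField.complexConj L) (2 + 2) (hermD L e dV hdV dW hdW) → ℂ), FiniteDimensional ℂ V ∧ A ∈ V ∧
          ∀ a₀ : UnitaryGroup.arch (Fp L) L (IsCMField.complexConj L) (2 + 2) (hermD L e dV hdV dW hdW),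
            (UnitaryGroup.archToAdelic (Fp L) L (IsCMField.complexConj L) (2 + 2) (hermD L e dV hdV dW hdW) a₀ : HA L e dV hdV dW hdW) ∈ 𝒦'.K → ∀ G ∈ V, (fun x => G (x * a₀)) ∈ V) →
        Continuous A →
        ∀ κ : HA L e dV hdV dW hdW, κ ∈ 𝒦'.K →
          ∀ {_ : MeasurableSpace ↥(unipDeltaArch L e dV hdV dW hdW)} [BorelSpace ↥(unipDeltaArch L e dV hdV dW hdW)]
            (νinf : Measure ↥(unipDeltaArch L e dV hdV dW hdW)) [νinf.IsHaarMeasure] [SigmaFinite νinf],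
            (∀ s : ℂ, 1 < s.re → Integrable (fun p : ↥(unipDeltaArch L e dV hdV dW hdW) =>
              ((modDelta L e dV hdV dW hdW (𝒦'.pPart (UnitaryGroup.archToAdelic (Fp L) L (IsCMField.complexConj L) (2 + 2) (hermD L e dV hdV dW hdW)
                  (UnitaryGroup.archPart (Fp L) L (IsCMField.complexConj L) (2 + 2) (hermD L e dV hdV dW hdW) (weylDelta L e dV hdV dW hdW) *
                    (p : UnitaryGroup.arch (Fp L) L (IsCMField.complexConj L) (2 + 2) (hermD L e dV hdV dW hdW)) *
                    UnitaryGroup.archPart (Fp L) L (IsCMField.complexConj L) (2 + 2) (hermD L e dV hdV dW hdW) κ))) : ℝ) : ℂ) ^ (2 * (s - s₀)) *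
                A (UnitaryGroup.archPart (Fp L) L (IsCMField.complexConj L) (2 + 2) (hermD L e dV hdV dW hdW) (weylDelta L e dV hdV dW hdW) *
                    (p : UnitaryGroup.arch (Fp L) L (IsCMField.complexConj L) (2 + 2) (hermD L e dV hdV dW hdW)) *
                    UnitaryGroup.archPart (Fp L) L (IsCMField.complexConj L) (2 + 2) (hermD L e dV hdV dW hdW) κ)) νinf) ∧
            ∃ Ea : ℂ → ℂ, DifferentiableOn ℂ Ea {s : ℂ | 0 < s.re} ∧ ∀ s : ℂ, 1 < s.re →
              ∫ p : ↥(unipDeltaArch L e dV hdV dW hdW),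
                ((modDelta L e dV hdV dW hdW (𝒦'.pPart (UnitaryGroup.archToAdelic (Fp L) L (IsCMField.complexConj L) (2 + 2) (hermD L e dV hdV dW hdW)
                  (UnitaryGroup.archPart (Fp L) L (IsCMField.complexConj L) (2 + 2) (hermD L e dV hdV dW hdW) (weylDelta L e dV hdV dW hdW) *
                    (p : UnitaryGroup.arch (Fp L) L (IsCMField.complexConj L) (2 + 2) (hermD L e dV hdV dW hdW)) *
                    UnitaryGroup.archPart (Fp L) L (IsCMField.complexConj L) (2 + 2) (hermD L e dV hdV dW hdW) κ))) : ℝ) : ℂ) ^ (2 * (s - s₀)) *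
                A (UnitaryGroup.archPart (Fp L) L (IsCMField.complexConj L) (2 + 2) (hermD L e dV hdV dW hdW) (weylDelta L e dV hdV dW hdW) *
                    (p : UnitaryGroup.arch (Fp L) L (IsCMField.complexConj L) (2 + 2) (hermD L e dV hdV dW hdW)) *
                    UnitaryGroup.archPart (Fp L) L (IsCMField.complexConj L) (2 + 2) (hermD L e dV hdV dW hdW) κ) ∂νinf = Ea s := by
  intro 𝒦' h𝒦' s₀ A hAlaw hfin hAc κ hκ _ _ νinf _ _
  -- the tube frames of record at every complex place (★ arch₄), `choose`n once
  choose T Tinv h1 h2 hTU hTS hTiv hTN hTV hW hTdef hTinvdef using fun w : {w : InfinitePlace L // w.IsComplex} =>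
    exists_tubeFrame_arch₄ L e dV hdV dW hdW w (UnitaryGroup.complexConj_smul_infinitePlace L w.1) hdV0 hdW0
  choose B C hCu hBC using hW
  have hDC := fun w : {w : InfinitePlace L // w.IsComplex} => isUnit_det_shimuraFrame (n := 2)
    (fun k => (w.1.embedding (dV (e.symm k).1 * dW (e.symm k).2)).re)
    (tw_ne_zero L e dV hdV dW hdW w (UnitaryGroup.complexConj_smul_infinitePlace L w.1) hdV0 hdW0)
  obtain ⟨Fr, hFr⟩ : ∃ Fr : UnitaryGroup.arch (Fp L) L (IsCMField.complexConj L) (2 + 2) (hermD L e dV hdV dW hdW) → {w : InfinitePlace L // w.IsComplex} → Matrix (Fin 2 ⊕ Fin 2) (Fin 2 ⊕ Fin 2) ℂ,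
      ∀ k w, Fr k w = T w * Matrix.reindex (e₂ (n := 2)).symm (e₂ (n := 2)).symm (((UnitaryGroup.archAt (Fp L) L (IsCMField.complexConj L) (2 + 2) (hermD L e dV hdV dW hdW) w (UnitaryGroup.complexConj_smul_infinitePlace L w.1) (IsCMField.complexConj_ne_one L) k : UnitaryGroup.archLocal L (2 + 2) (hermD L e dV hdV dW hdW) w) : GL (Fin (2 + 2)) ℂ) : Matrix (Fin (2 + 2)) (Fin (2 + 2)) ℂ) * Tinv w :=
    ⟨_, fun _ _ => rfl⟩
  -- reading frames
  obtain ⟨fr, hfrM, hfrc, -⟩ := exists_readingFrame L e dV hdV dW hdW hdV0 hdW0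
  have hfrτ : ∀ w (u : Matrix.unitaryGroup (Fin 2) ℂ),
      T w * Matrix.reindex (e₂ (n := 2)).symm (e₂ (n := 2)).symm (((fr w u : UnitaryGroup.archLocal L (2 + 2) (hermD L e dV hdV dW hdW) w) : GL (Fin (2 + 2)) ℂ) :
        Matrix (Fin (2 + 2)) (Fin (2 + 2)) ℂ) * Tinv w =
      (2 : ℂ)⁻¹ • fromBlocks (1 + (u : Matrix (Fin 2) (Fin 2) ℂ)) (-(I • (1 - (u : Matrix (Fin 2) (Fin 2) ℂ)))) (I • (1 - (u : Matrix (Fin 2) (Fin 2) ℂ))) (1 + (u : Matrix (Fin 2) (Fin 2) ℂ)) := by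
    intro w u
    have hG := hfrM w u
    rw [← hTdef w, ← hTinvdef w] at hG
    rw [tube_eq_of_chart_formula (T w) (Tinv w) (h1 w) hG, kappa_eq]
  -- the conjugator letter
  obtain ⟨g, hg⟩ := hconj 𝒦' h𝒦' T Tinv hTdef hTinvdef
  have hg' : ∀ k : UnitaryGroup.arch (Fp L) L (IsCMField.complexConj L) (2 + 2) (hermD L e dV hdV dW hdW), (∀ w, moeb (Fr k w) (I • (1 : Matrix (Fin 2) (Fin 2) ℂ)) = I • 1) →
      (UnitaryGroup.archToAdelic (Fp L) L (IsCMField.complexConj L) (2 + 2) (hermD L e dV hdV dW hdW) (g * k * g⁻¹) : HA L e dV hdV dW hdW) ∈ 𝒦'.K :=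
    fun k hk => hg k fun w => by rw [← hFr]; exact hk w
  -- (E6′)'s arch letters in the ★ (law)-dictionary currency
  have hA : IsArchSiegelDeltaSection L e dV hdV dW hdW χ s₀ A := isArchSiegelDeltaSection_of_finPart_eq_one L e dV hdV dW hdW hAlaw
  have hK : IsArchKFinite L e dV hdV dW hdW 𝒦' A := hfin
  -- ★ FILE 18: the flat tube presentation at the translated point
  obtain ⟨m, c, Q, F, hFs, hQs, hpres⟩ := exists_flat_tube_presentation L e dV hdV hdV0 dW hdW hdW0 T Tinv Fr hFr h1 h2 hTU hTS hTV
    (fun w => diagonal fun k => (Real.sqrt (|(w.1.embedding (dV (e.symm k).1 * dW (e.symm k).2)).re| / 2) : ℂ))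
    (fun w => diagonal fun k => I * ((((w.1.embedding (dV (e.symm k).1 * dW (e.symm k).2)).re / |(w.1.embedding (dV (e.symm k).1 * dW (e.symm k).2)).re|) *
      Real.sqrt (|(w.1.embedding (dV (e.symm k).1 * dW (e.symm k).2)).re| / 2) : ℝ) : ℂ))
    hTdef (fun w => (hDC w).1) (fun w => (hDC w).2) fr hfrc hfrτ 𝒦' g hg' ht s₀ hA hK hAc
  -- ★ K2Liu-p13's assembly half at `F s a := H(a)^{2(s−s₀)}·A a`, `γ r s := c r · H(g⁻¹)^{2(s−s₀)}`, point `κ_∞`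
  have hC0 : (((modDelta L e dV hdV dW hdW (𝒦'.pPart (UnitaryGroup.archToAdelic (Fp L) L (IsCMField.complexConj L) (2 + 2) (hermD L e dV hdV dW hdW) g⁻¹)) : ℝ) : ℂ)) ≠ 0 := by
    exact_mod_cast (modDelta_pos L e dV hdV dW hdW _).ne'
  have hpow : Differentiable ℂ fun s : ℂ =>
      (((modDelta L e dV hdV dW hdW (𝒦'.pPart (UnitaryGroup.archToAdelic (Fp L) L (IsCMField.complexConj L) (2 + 2) (hermD L e dV hdV dW hdW) g⁻¹)) : ℝ) : ℂ)) ^ (2 * (s - s₀)) :=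
    ((differentiable_id.sub_const s₀).const_mul (2 : ℂ)).const_cpow (Or.inl hC0)
  have hγ : ∀ r : Fin m, DifferentiableOn ℂ (fun s : ℂ => c r *
      (((modDelta L e dV hdV dW hdW (𝒦'.pPart (UnitaryGroup.archToAdelic (Fp L) L (IsCMField.complexConj L) (2 + 2) (hermD L e dV hdV dW hdW) g⁻¹)) : ℝ) : ℂ)) ^ (2 * (s - s₀)))
      {s : ℂ | 0 < s.re} := fun r => ((differentiable_const (c r)).mul hpow).differentiableOn
  have hpres' : ∀ (s : ℂ) (a : UnitaryGroup.arch (Fp L) L (IsCMField.complexConj L) (2 + 2) (hermD L e dV hdV dW hdW)),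
      (((modDelta L e dV hdV dW hdW (𝒦'.pPart (UnitaryGroup.archToAdelic (Fp L) L (IsCMField.complexConj L) (2 + 2) (hermD L e dV hdV dW hdW) a)) : ℝ) : ℂ) ^
          (2 * (s - s₀))) * A a =
        ∑ r, (c r * (((modDelta L e dV hdV dW hdW (𝒦'.pPart (UnitaryGroup.archToAdelic (Fp L) L (IsCMField.complexConj L) (2 + 2) (hermD L e dV hdV dW hdW) g⁻¹)) : ℝ) : ℂ)) ^
          (2 * (s - s₀))) *
          ∏ w, (((‖(Literature.NumberTheory.ModularForms.SiegelUpperHalfSpace.denom (Fr (a * g) w) (I • (1 : Matrix (Fin 2) (Fin 2) ℂ))).det‖ : ℝ) : ℂ) ^ (2 * (s₀ - s))) *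
            F r w (Fr (a * g) w) := fun s a => by
    rw [hpres s a, Finset.mul_sum]
    refine Finset.sum_congr rfl fun r _ => ?_
    ring
  have hface := archFace_of_presentation L e dV hdV dW hdW T Tinv Fr hFr h2 hTU h1 hTiv hTN νinf B C hBC (fun w => -(t w.1)) (fun w => (hodd w.1).neg) Q
    (fun r s => c r * (((modDelta L e dV hdV dW hdW (𝒦'.pPart (UnitaryGroup.archToAdelic (Fp L) L (IsCMField.complexConj L) (2 + 2) (hermD L e dV hdV dW hdW) g⁻¹)) : ℝ) : ℂ)) ^
      (2 * (s - s₀))) hγ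
    (fun s r w x => (((‖(Literature.NumberTheory.ModularForms.SiegelUpperHalfSpace.denom x (I • (1 : Matrix (Fin 2) (Fin 2) ℂ))).det‖ : ℝ) : ℂ) ^ (2 * (s₀ - s))) * F r w x)
    hFs hQs g
    (fun s a => (((modDelta L e dV hdV dW hdW (𝒦'.pPart (UnitaryGroup.archToAdelic (Fp L) L (IsCMField.complexConj L) (2 + 2) (hermD L e dV hdV dW hdW) a)) : ℝ) : ℂ) ^
      (2 * (s - s₀))) * A a) hpres'
    (UnitaryGroup.archPart (Fp L) L (IsCMField.complexConj L) (2 + 2) (hermD L e dV hdV dW hdW) κ)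
  exact hface

end Summit.HodgeConjecture.HodgeConjecture.Cruxes.HLiu418.K2LiuArchFaceOfRecord

end
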